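import Summits.Ventures.HodgeRepro2.T6B1Carriers

/-!
# T6B1Toy — non-vacuity witnesses for the B1 carriers (Tier-6 sub-goal B1; README §10.5(ii)(c)–(d))

The carriers of `T6B1Carriers` are inhabited on the toy datum `K = ℚ`, `θ = −1` (`E = ℚ(i)`): the standard form
`I₃` is an `AdelicHermitianSpace ℚ (−1) 3` and a `GlobalHermitianSpace ℚ (−1) 3`; it is totally positive definite;
`diag(1, 1, −1)` has signature `(2, 1)`; the §63B symbol and the §65A local norms take both values over `ℝ`
(`(1, −1) = 1`, `(−1, −1) = −1`). Nothing here is a display or a hypothesis; the displayed O'Meara statements are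
theorems of `ℚ` (their kernel proofs are not attempted — Mathlib has no Hilbert symbol theory).
-/

namespace Summit.Ventures.HodgeRepro2.T6
namespace B1Toy

open NumberField Matrix B1Carriers
open scoped ComplexOrder

noncomputable section

/-- The standard form `I₃` over `A_{ℚ(i)}` as an adelic hermitian space. -/
def toyAdelic : AdelicHermitianSpace ℚ (-1) 3 where
  gram := 1
  isHermitian := Matrix.isHermitian_one
  isUnit_det := by rw [Matrix.det_one]; exact isUnit_one

/-- The standard form `I₃` over `ℚ(i)` as a global hermitian space. -/
def toyGlobal : GlobalHermitianSpace ℚ (-1) 3 where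
  gram := 1
  isHermitian := Matrix.isHermitian_one
  isUnit_det := by rw [Matrix.det_one]; exact isUnit_one

/-- `I₃` is totally positive definite. -/
theorem toyAdelic_isTotallyPositiveDefinite : IsTotallyPositiveDefinite ℚ toyAdelic := by
  intro w hw
  show ((1 : Matrix (Fin 3) (Fin 3) (AE ℚ (-1))).map (adelicToComplex ℚ (-1) hw)).PosDef
  rw [Matrix.map_one _ (map_zero _) (map_one _)]
  exact Matrix.PosDef.one

/-- `diag(1, 1, −1)` has signature `(2, 1)`. -/
theorem hasSig_toy : HasSig (Matrix.diagonal (fun i : Fin 3 => if (i : ℕ) < 2 then (1 : ℂ) else -1)) 2 1 :=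
  ⟨rfl, 1, by simp, by simp⟩

/-- The carriers at a real place: `(1, −1) = 1` in `ℝ`. -/
theorem hilbertEqnSolvable_one_neg_one : HilbertEqnSolvable ℝ 1 (-1) := ⟨1, 0, by norm_num⟩

/-- `(−1, −1) = −1` in `ℝ`: `−ξ² − η² = 1` has no real solution. -/
theorem not_hilbertEqnSolvable_neg_one_neg_one : ¬ HilbertEqnSolvable ℝ (-1) (-1) := by
  rintro ⟨ξ, η, h⟩
  nlinarith [sq_nonneg ξ, sq_nonneg η]

/-- `2 = 1² − (−1)·1²` is a local norm from `ℝ(i) = ℂ`. -/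
theorem isNormFrom_two : IsNormFrom ℝ (-1) 2 := ⟨1, 1, by norm_num⟩

/-- `−1` is not a local norm from `ℂ`: `x² + y² ≥ 0`. -/
theorem not_isNormFrom_neg_one : ¬ IsNormFrom ℝ (-1) (-1) := by
  rintro ⟨x, y, h⟩
  nlinarith [sq_nonneg x, sq_nonneg y]

/-- The unitary group of `I₃` over `ℚ(i)` is a subgroup of `GL₃(ℚ(i))` containing `1` (non-empty carrier). -/
theorem one_mem_toy_unitary : (1 : GL (Fin 3) (Ext ℚ (-1))) ∈ globalUnitaryGroup ℚ toyGlobal :=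
  (globalUnitaryGroup ℚ toyGlobal).one_mem

end

end B1Toy
end Summit.Ventures.HodgeRepro2.T6
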